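import Mathlib
import Literature.Computability.AlgebraicComplexity.StandardFamilies
import Literature.Computability.AlgebraicComplexity.PermanentIrreducible
import Summits.ValiantsHypothesis.ValiantsHypothesis.Theorems.ValuativeGCTValuativeFlipTangentRank

/-!
# Border apolarity, crux `ToricWitnessObstructionQP` — stub `stub_lieStabilizer_per`
# (S2, the Lie stabiliser of `per_n`)

Route `ValiantsHypothesis/BorderApolarity`, crux item `stmt-ValiantsHypothesis-14753`,
line `Sketch`, stub `stub_lieStabilizer_per`.  The Lie algebra of the stabiliser of the generic
permanent `per_n` (`n ≥ 3`) inside `gl(n²)` is the torus `t(E) ⊕ t(F)` (Marcus–May 1962,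
Botta 1967; Landsberg, *Geometry and Complexity Theory* 2017, §6.6): if the infinitesimal linear
substitution `E_M = ∑_{a,b} M_{ba} X_b ∂_a` rescales `per_n`, `E_M per_n = c · per_n`, then `M` is
diagonal and its diagonal `d (i, j) = M_{(ij)(ij)}` is exchange-additive,
`d(i,j) + d(k,l) = d(i,l) + d(k,j)` (i.e. `d (i, j) = α_i + β_j`).  This is where "the stabiliser
of the permanent is small" enters the normal form of toric degenerations onto the padded permanent.

Proof: coefficient extraction (`lieRel_coeff`).  Writing `X a * ∂_b per = ∑_{σ : σ b.2 = b.1} X^e`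
with `e = e_a + μ_σ - e_b` (`μ_σ` the permutation monomial of `σ`), the monomial bookkeeping of the
tree file `ValuativeGCTValuativeFlipTangentRank.lean` (tangent rank of the permanent: row/column
signatures, type-S monomials are private, type-T monomials pair two same-row members) is reused:
type S gives `M b a = 0` for `b.1 ≠ a.1`, `b.2 ≠ a.2` (`lieRel_S`); type T gives
`g(r) + g(s) = 0` for the same-row entries of two distinct rows, and three rows (`n ≥ 3`,
characteristic `0`) force `g = 0` (`lieRel_T`); columns follow by the symmetry `per(Xᵀ) = per(X)`
(`lieRel_swap`).  None of these monomials is a permutation monomial, so the right-hand side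
`c · per_n` does not interfere.  Finally the permutation monomial `μ_τ` only occurs in the diagonal
members `X b ∂_b per` with `b` a cell of `τ` (`card_filter_permMonomial`), so
`∑ j, M (τ j, j) (τ j, j) = c` for every `τ` (`lieRel_diag_sum`); comparing `τ` with `τ ∘ (j l)`
gives additivity.
-/

open MvPolynomial
open scoped BigOperators Matrix
open Literature.Computability.AlgebraicComplexity
open Summit.ValiantsHypothesis.ValiantsHypothesis.Theorems.ValuativeFlip

-- the mandated summit-side namespace repeats a component by design (single-problem summit)
set_option linter.dupNamespace false

namespace Summit.ValiantsHypothesis.ValiantsHypothesis.Theorems.BorderApolarityToricWitnessObstructionQP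

variable {ι : Type*} [Fintype ι] [DecidableEq ι] (K : Type*) [Field K]

/-! ## More monomial bookkeeping for the family `X a * ∂_b per` -/

/-- `e_b + (μ_σ - e_b) = μ_σ` when `b` is a cell of `σ`. [folklore] -/
theorem tExp_self {σ : Equiv.Perm ι} {b : ι × ι} (hσ : σ b.2 = b.1) :
    Finsupp.single b (1 : ℕ) + (permMonomial σ - Finsupp.single b (1 : ℕ)) = permMonomial σ :=
  (add_comm _ _).trans (Finsupp.sub_add_single_one_cancel
    (by rw [tr_permMonomial_eq, if_pos hσ]; exact one_ne_zero))

/-- The exponent `e_a + μ_σ - e_b` of an off-diagonal member (`a ≠ b`, `σ b.2 = b.1`) is never a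
permutation monomial: one of its row or column sums is not `1`. [folklore] -/
theorem tExp_ne_permMonomial {σ : Equiv.Perm ι} {a b : ι × ι} (hσ : σ b.2 = b.1) (hab : a ≠ b)
    (τ : Equiv.Perm ι) :
    Finsupp.single a (1 : ℕ) + (permMonomial σ - Finsupp.single b (1 : ℕ)) ≠ permMonomial τ := by
  intro h
  apply hab
  have hr := tr_rowCount_trExp hσ a b.1
  have hc := tr_colCount_trExp hσ a b.2
  rw [h, rowCount_permMonomial, if_pos rfl] at hr
  rw [h, colCount_permMonomial, if_pos rfl] at hc
  refine Prod.ext ?_ ?_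
  · by_contra hne
    rw [if_neg (fun h' => hne h'.symm)] at hr
    omega
  · by_contra hne
    rw [if_neg (fun h' => hne h'.symm)] at hc
    omega

/-- Hence the permanent has coefficient `0` at the exponent of an off-diagonal member. [folklore] -/
theorem coeff_tExp_perPoly {σ : Equiv.Perm ι} {a b : ι × ι} (hσ : σ b.2 = b.1) (hab : a ≠ b) :
    coeff (Finsupp.single a (1 : ℕ) + (permMonomial σ - Finsupp.single b (1 : ℕ)))
      (perPoly ι K) = 0 := by
  rw [coeff_perPoly]
  exact Finset.sum_eq_zero fun τ _ => if_neg fun h => tExp_ne_permMonomial hσ hab τ h.symm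

/-- **Type-S count.** At the exponent of the `swap b.2 b.1`-term of a type-S member `p = (a, b)`
(`a.1 ≠ b.1`, `a.2 ≠ b.2`), the member `p` has exactly one term and every other member `q` has
none. [folklore] -/
theorem card_filter_typeS (p : (ι × ι) × (ι × ι)) (h1 : p.1.1 ≠ p.2.1) (h2 : p.1.2 ≠ p.2.2)
    (q : (ι × ι) × (ι × ι)) :
    ((Finset.univ.filter fun σ : Equiv.Perm ι => σ q.2.2 = q.2.1 ∧
        Finsupp.single q.1 (1 : ℕ) + (permMonomial σ - Finsupp.single q.2 (1 : ℕ)) =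
          Finsupp.single p.1 (1 : ℕ) +
            (permMonomial (Equiv.swap p.2.2 p.2.1) - Finsupp.single p.2 (1 : ℕ))).card : K) =
      if q = p then 1 else 0 := by
  have hσ₀ : Equiv.swap p.2.2 p.2.1 p.2.2 = p.2.1 := Equiv.swap_apply_left _ _
  by_cases hq : q = p
  · rw [if_pos hq, hq]
    exact tr_card_one K ⟨hσ₀, rfl⟩ fun σ h => tr_perm_eq_of_trExp_eq hσ₀ h.1 h.2
  · rw [if_neg hq]
    refine tr_card_zero K fun σ h => hq ?_
    obtain ⟨ha, hb, -⟩ := tr_S_unique h1 h2 hσ₀ h.1 h.2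
    exact Prod.ext ha hb

/-- **Type-T count.** At the exponent of the `σ`-term of `((r, j), (r, l))` (`j ≠ l`, `σ l = r`,
`σ j = s`), exactly the two same-row members `((r, j), (r, l))` and `((s, j), (s, l))` have a
term, one each. [folklore] -/
theorem card_filter_typeT {j l r s : ι} (hjl : j ≠ l) (hrs : r ≠ s) {σ : Equiv.Perm ι}
    (hσl : σ l = r) (hσj : σ j = s) (q : (ι × ι) × (ι × ι)) :
    ((Finset.univ.filter fun σ' : Equiv.Perm ι => σ' q.2.2 = q.2.1 ∧
        Finsupp.single q.1 (1 : ℕ) + (permMonomial σ' - Finsupp.single q.2 (1 : ℕ)) =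
          Finsupp.single (r, j) (1 : ℕ) +
            (permMonomial σ - Finsupp.single (r, l) (1 : ℕ))).card : K) =
      (if q = ((r, j), (r, l)) then 1 else 0) + (if q = ((s, j), (s, l)) then 1 else 0) := by
  have hτ : (σ * Equiv.swap j l) l = s := by
    rw [Equiv.Perm.mul_apply, Equiv.swap_apply_right, hσj]
  have hsw := tr_T_swap_trExp hjl hσl hσj
  by_cases hqr : q = ((r, j), (r, l))
  · subst hqr
    rw [if_pos rfl, if_neg (fun h => hrs (congr_arg (fun q : (ι × ι) × (ι × ι) => q.1.1) h)),
      add_zero]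
    exact tr_card_one K ⟨hσl, rfl⟩ fun σ' h =>
      tr_perm_eq_of_trExp_eq (b := (r, l)) hσl h.1 h.2
  by_cases hqs : q = ((s, j), (s, l))
  · subst hqs
    rw [if_neg hqr, if_pos rfl, zero_add]
    exact tr_card_one K ⟨hτ, hsw⟩ fun σ' h =>
      tr_perm_eq_of_trExp_eq (b := (s, l)) hτ h.1 (h.2.trans hsw.symm)
  rw [if_neg hqr, if_neg hqs, add_zero]
  refine tr_card_zero K fun σ' h => ?_
  obtain ⟨hq1, hq2, hq3⟩ := tr_T_classify (a := (r, j)) (b := (r, l)) rfl hjl hσl h.1 h.2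
  have hqG : q = ((q.1.1, j), (q.1.1, l)) :=
    Prod.ext (Prod.ext rfl hq2) (Prod.ext hq1.symm hq3)
  obtain ⟨h5, h6⟩ := h
  rw [hq3, ← hq1] at h5
  rw [hqG] at h6
  rcases tr_T_rows hjl hσl hσj h5 h6 with htr | hts
  · exact hqr (hqG.trans (by rw [htr]))
  · exact hqs (hqG.trans (by rw [hts]))

/-- **Permutation-monomial count.** The permutation monomial `μ_τ` occurs (once) exactly in the
diagonal members `X b * ∂_b per` with `b` a cell of `τ`. [folklore] -/
theorem card_filter_permMonomial (τ : Equiv.Perm ι) (q : (ι × ι) × (ι × ι)) :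
    ((Finset.univ.filter fun σ : Equiv.Perm ι => σ q.2.2 = q.2.1 ∧
        Finsupp.single q.1 (1 : ℕ) + (permMonomial σ - Finsupp.single q.2 (1 : ℕ)) =
          permMonomial τ).card : K) = if q.1 = q.2 ∧ τ q.2.2 = q.2.1 then 1 else 0 := by
  by_cases h : q.1 = q.2 ∧ τ q.2.2 = q.2.1
  · rw [if_pos h]
    obtain ⟨h1, h2⟩ := h
    refine tr_card_one K ⟨h2, by rw [h1, tExp_self h2]⟩ fun σ hσ => ?_
    obtain ⟨hσ, he⟩ := hσ
    rw [h1, tExp_self hσ] at he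
    exact permMonomial_injective he
  · rw [if_neg h]
    refine tr_card_zero K fun σ hσ => ?_
    obtain ⟨hσ, he⟩ := hσ
    by_cases h1 : q.1 = q.2
    · rw [h1, tExp_self hσ] at he
      obtain rfl := permMonomial_injective he
      exact h ⟨h1, hσ⟩
    · exact tExp_ne_permMonomial hσ h1 τ he

/-! ## Coefficient extraction from a Lie relation `∑_p g p • (X p.1 * ∂_{p.2} per) = c • per` -/

/-- **Coefficient extraction.** If `∑_p g p • (X p.1 * ∂_{p.2} per) = c • per` then, at every
exponent `d`, `∑_p g p * #{σ-terms of p with exponent d} = c * coeff d per`. [folklore] -/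
theorem lieRel_coeff {g : (ι × ι) × (ι × ι) → K} {c : K}
    (hg : ∑ p : (ι × ι) × (ι × ι), g p • (X p.1 * pderiv p.2 (perPoly ι K)) = c • perPoly ι K)
    (d : ι × ι →₀ ℕ) :
    ∑ p : (ι × ι) × (ι × ι), g p *
        ((Finset.univ.filter fun σ : Equiv.Perm ι => σ p.2.2 = p.2.1 ∧
          Finsupp.single p.1 (1 : ℕ) + (permMonomial σ - Finsupp.single p.2 (1 : ℕ)) = d).card :
          K) =
      c * coeff d (perPoly ι K) := by
  simpa only [coeff_sum, coeff_smul, smul_eq_mul, tr_coeff_X_mul_pderiv_perPoly] using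
    congr_arg (coeff d) hg

/-- **Transposition.** The relation is preserved by transposing all indices, since
`per(Xᵀ) = per(X)`. [folklore] -/
theorem lieRel_swap {g : (ι × ι) × (ι × ι) → K} {c : K}
    (hg : ∑ p : (ι × ι) × (ι × ι), g p • (X p.1 * pderiv p.2 (perPoly ι K)) = c • perPoly ι K) :
    ∑ p : (ι × ι) × (ι × ι), g (p.1.swap, p.2.swap) • (X p.1 * pderiv p.2 (perPoly ι K)) =
      c • perPoly ι K := by
  have h := congr_arg (rename (Prod.swap : ι × ι → ι × ι)) hg
  rw [map_sum] at h
  simp only [map_smul, map_mul, rename_X, ← pderiv_rename Prod.swap_injective,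
    tr_rename_swap_perPoly] at h
  have hθ : Function.Involutive fun p : (ι × ι) × (ι × ι) => (p.1.swap, p.2.swap) := fun p => by
    simp
  rw [← hθ.bijective.sum_comp]
  convert h using 2 with p
  simp only [Prod.swap_swap]

/-- **Step S.** The coefficient of a type-S member (`p.1.1 ≠ p.2.1`, `p.1.2 ≠ p.2.2`) vanishes: its
monomials are private and are not permutation monomials. [folklore] -/
theorem lieRel_S {g : (ι × ι) × (ι × ι) → K} {c : K}
    (hg : ∑ p : (ι × ι) × (ι × ι), g p • (X p.1 * pderiv p.2 (perPoly ι K)) = c • perPoly ι K)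
    (p : (ι × ι) × (ι × ι)) (h1 : p.1.1 ≠ p.2.1) (h2 : p.1.2 ≠ p.2.2) : g p = 0 := by
  have hσ₀ : Equiv.swap p.2.2 p.2.1 p.2.2 = p.2.1 := Equiv.swap_apply_left _ _
  have hp : p.1 ≠ p.2 := fun h => h1 (by rw [h])
  have h0 := coeff_tExp_perPoly K hσ₀ hp
  simpa [card_filter_typeS K p h1 h2, h0] using lieRel_coeff K hg
    (Finsupp.single p.1 (1 : ℕ) +
      (permMonomial (Equiv.swap p.2.2 p.2.1) - Finsupp.single p.2 (1 : ℕ)))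

/-- **Step T.** In characteristic `0` and with `3 ≤ |ι|`, the coefficient of a same-row member
(`p.1.1 = p.2.1`, `p.1.2 ≠ p.2.2`) vanishes: same-row members pair up on type-T monomials, and
three rows force zero. [folklore] -/
theorem lieRel_T [CharZero K] (h3 : 3 ≤ Fintype.card ι) {g : (ι × ι) × (ι × ι) → K} {c : K}
    (hg : ∑ p : (ι × ι) × (ι × ι), g p • (X p.1 * pderiv p.2 (perPoly ι K)) = c • perPoly ι K)
    (p : (ι × ι) × (ι × ι)) (h1 : p.1.1 = p.2.1) (h2 : p.1.2 ≠ p.2.2) : g p = 0 := by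
  set j := p.1.2
  set l := p.2.2
  have hpair : ∀ r s : ι, r ≠ s → g ((r, j), (r, l)) + g ((s, j), (s, l)) = 0 := by
    intro r s hrs
    obtain ⟨σ, hσl, hσj⟩ := tr_exists_perm h2 hrs
    have h0 : coeff (Finsupp.single (r, j) (1 : ℕ) +
        (permMonomial σ - Finsupp.single (r, l) (1 : ℕ))) (perPoly ι K) = 0 :=
      coeff_tExp_perPoly K (b := (r, l)) hσl fun h => h2 (Prod.mk.inj h).2
    simpa [card_filter_typeT K h2 hrs hσl hσj, h0, mul_add, Finset.sum_add_distrib] using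
      lieRel_coeff K hg
        (Finsupp.single (r, j) (1 : ℕ) + (permMonomial σ - Finsupp.single (r, l) (1 : ℕ)))
  obtain ⟨s, u, hsr, hur, hsu⟩ := tr_exists_three h3 p.1.1
  have e1 := hpair _ _ hsr.symm
  have e2 := hpair _ _ hsu
  have e3 := hpair _ _ hur.symm
  have h2g : (2 : K) * g ((p.1.1, j), (p.1.1, l)) = 0 := by linear_combination e1 - e2 + e3
  rw [show p = ((p.1.1, j), (p.1.1, l)) from Prod.ext (Prod.ext rfl rfl) (Prod.ext h1.symm rfl)]
  exact (mul_eq_zero.mp h2g).resolve_left two_ne_zero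

/-- **Off-diagonal vanishing** for a general coefficient function: in characteristic `0` and with
`3 ≤ |ι|`, `g p = 0` for every `p` with `p.1 ≠ p.2` (type S directly, same row by step T, same
column by step T after transposition). [folklore] -/
theorem lieRel_offDiag [CharZero K] (h3 : 3 ≤ Fintype.card ι) {g : (ι × ι) × (ι × ι) → K} {c : K}
    (hg : ∑ p : (ι × ι) × (ι × ι), g p • (X p.1 * pderiv p.2 (perPoly ι K)) = c • perPoly ι K)
    (p : (ι × ι) × (ι × ι)) (hp : p.1 ≠ p.2) : g p = 0 := by
  by_cases h1 : p.1.1 = p.2.1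
  · exact lieRel_T K h3 hg p h1 fun h2 => hp (Prod.ext h1 h2)
  by_cases h2 : p.1.2 = p.2.2
  · simpa using lieRel_T K h3 (lieRel_swap K hg) (p.1.swap, p.2.swap) h2 h1
  · exact lieRel_S K hg p h1 h2

/-- **Diagonal sums along permutations.** Coefficient extraction at the permutation monomial
`μ_τ`: `∑ j, g ((τ j, j), (τ j, j)) = c` for every permutation `τ`. [folklore] -/
theorem lieRel_diag_sum {g : (ι × ι) × (ι × ι) → K} {c : K}
    (hg : ∑ p : (ι × ι) × (ι × ι), g p • (X p.1 * pderiv p.2 (perPoly ι K)) = c • perPoly ι K)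
    (τ : Equiv.Perm ι) : ∑ j, g ((τ j, j), (τ j, j)) = c := by
  have h := lieRel_coeff K hg (permMonomial τ)
  rw [coeff_permMonomial_perPoly, mul_one] at h
  simp only [card_filter_permMonomial K τ, mul_ite, mul_one, mul_zero] at h
  rw [← h, Fintype.sum_prod_type]
  simp only [ite_and, Finset.sum_ite_eq, Finset.mem_univ, if_true]
  rw [Fintype.sum_prod_type, Finset.sum_comm]
  simp only [Finset.sum_ite_eq, Finset.mem_univ, if_true]

/-! ## The Lie stabiliser of the permanent -/

/-- **Lie stabiliser of the permanent, off-diagonal part** (Marcus–May 1962, Botta 1967;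
Landsberg 2017, §6.6).  If `3 ≤ |ι|`, `char K = 0` and
`∑ a, ∑ b, M b a • (X b * ∂_a per_ι) = c • per_ι`, then `M` is diagonal. [folklore] -/
theorem perPoly_lieStabilizer_offDiag [CharZero K] (h3 : 3 ≤ Fintype.card ι)
    (M : Matrix (ι × ι) (ι × ι) K) (c : K)
    (hM : ∑ a, ∑ b, M b a • (X b * pderiv a (perPoly ι K)) = c • perPoly ι K)
    (a b : ι × ι) (hab : b ≠ a) : M b a = 0 :=
  lieRel_offDiag K h3
    ((Fintype.sum_prod_type_right' fun b a => M b a • (X b * pderiv a (perPoly ι K))).trans hM)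
    (b, a) hab

/-- **Lie stabiliser of the permanent, diagonal part** (Marcus–May 1962, Botta 1967; Landsberg
2017, §6.6).  If `∑ a, ∑ b, M b a • (X b * ∂_a per_ι) = c • per_ι` then the diagonal of `M` is
exchange-additive: `M (i,j) (i,j) + M (k,l) (k,l) = M (i,l) (i,l) + M (k,j) (k,j)` (no hypothesis
on `|ι|` or on the characteristic is needed here). [folklore] -/
theorem perPoly_lieStabilizer_diag_additive (M : Matrix (ι × ι) (ι × ι) K) (c : K)
    (hM : ∑ a, ∑ b, M b a • (X b * pderiv a (perPoly ι K)) = c • perPoly ι K) (i j k l : ι) :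
    M (i, j) (i, j) + M (k, l) (k, l) = M (i, l) (i, l) + M (k, j) (k, j) := by
  by_cases hik : i = k
  · subst hik
    exact add_comm _ _
  by_cases hjl : j = l
  · subst hjl
    rfl
  have hg : ∑ p : (ι × ι) × (ι × ι), M p.1 p.2 • (X p.1 * pderiv p.2 (perPoly ι K)) =
      c • perPoly ι K :=
    (Fintype.sum_prod_type_right' fun b a => M b a • (X b * pderiv a (perPoly ι K))).trans hM
  obtain ⟨σ, hσl, hσj⟩ := tr_exists_perm hjl (Ne.symm hik)
  have e1 : ∑ x, M (σ x, x) (σ x, x) = c := lieRel_diag_sum K hg σ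
  have e2 : ∑ x, M ((σ * Equiv.swap j l) x, x) ((σ * Equiv.swap j l) x, x) = c :=
    lieRel_diag_sum K hg (σ * Equiv.swap j l)
  have key : ∑ x, (M (σ x, x) (σ x, x) -
      M ((σ * Equiv.swap j l) x, x) ((σ * Equiv.swap j l) x, x)) =
        (M (i, j) (i, j) - M (k, j) (k, j)) + (M (k, l) (k, l) - M (i, l) (i, l)) := by
    rw [Fintype.sum_eq_add j l hjl]
    · simp [Equiv.Perm.mul_apply, Equiv.swap_apply_left, Equiv.swap_apply_right, hσl, hσj]
    · rintro x ⟨hxj, hxl⟩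
      simp [Equiv.Perm.mul_apply, Equiv.swap_apply_of_ne_of_ne hxj hxl]
  rw [Finset.sum_sub_distrib, e1, e2, sub_self] at key
  linear_combination -key

/-- **S2 (Lie stabiliser of the permanent, `n ≥ 3`).** If `Σ_{a,b} M_{ba} X_b ∂_a per_n = c · per_n`
then `M` is diagonal and its diagonal is exchange-additive: `M_{(ij)(ij)} + M_{(kl)(kl)} =
M_{(il)(il)} + M_{(kj)(kj)}` (Marcus–May 1962, Botta 1967; Landsberg 2017, §6.6). [folklore] -/
theorem stub_lieStabilizer_per : ∀ (n : ℕ), 3 ≤ n →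
    ∀ (M : Matrix (Fin n × Fin n) (Fin n × Fin n) ℂ) (c : ℂ),
    ∑ a, ∑ b, M b a • (X b * pderiv a (perPoly (Fin n) ℂ)) = c • perPoly (Fin n) ℂ →
    (∀ a b : Fin n × Fin n, b ≠ a → M b a = 0) ∧
    (∀ i j k l : Fin n, M (i, j) (i, j) + M (k, l) (k, l) = M (i, l) (i, l) + M (k, j) (k, j)) :=
  fun n hn M c h =>
    ⟨fun a b hab => perPoly_lieStabilizer_offDiag ℂ (by simpa using hn) M c h a b hab,
      fun i j k l => perPoly_lieStabilizer_diag_additive ℂ M c h i j k l⟩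

end Summit.ValiantsHypothesis.ValiantsHypothesis.Theorems.BorderApolarityToricWitnessObstructionQP
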